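import Summits.HubbardSuperconductivity.HubbardSuperconductivity.Theorems.AnisotropyChordTransferFibre3FinX3Eval

/-!
# Route `AnisotropyChord` / H0 rotor rung: FIN per-`L` GM₃ (X5), `L = 30` — rows `N₁` / D / side-condition cell facts, part `p60`

Kernel facts (`decide +kernel`) for cert cells 140, 141 of the per-`L` grid of `L = 30`: `xbnCellAny2` (row `N₁` on XB2 point wedges recomputed in the kernel, exporting the literal brackets `nt ⊇ T⁺ − 3λ₂` and `tb ⊇ T⁺·D`), `xdCellAnyN0` (row D, reads `nt`), `sdCellAnyZN` (side condition, reads `nt`); evaluators `…FinX3Eval` / `…FinX5Eval`; constants from the compiled design probe (x3probe/x3plan, margins c ×0.985, b ×1.03, aD ×1.03); assembled in `…FinX5GM3Thirty`.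
Prover seat `hubbard-h0-rotor-p3` g8; helper for piece A = stmt-HubbardSuperconductivity-23918 of rung 19089 (`--supports`, helper class).
WHAT THIS IS NOT: nothing here proves superconductivity in the Hubbard model (rotor TARGET as worded stays FALSE, g15 verdict); kernel facts for the FIN certificate of ONE conditional reduction.  Tree imports only; zero data; standard axioms.
-/

set_option linter.dupNamespace false
set_option autoImplicit false

namespace Summit.HubbardSuperconductivity.HubbardSuperconductivity.Theorems.AnisotropyChord.Transfer.Fibre3

namespace FinXD

open FinXB FinCell Hole2

set_option maxHeartbeats 4000000 in
/-- row `N₁` of cell 140 of `L = 30` (`c = 111/200`), exporting `nt`, `tb`. [folklore] -/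
theorem xn30_140 : xbnCellAny2 30 (49/50 : ℚ) 1837608457606559 1883548669046723 (111/200 : ℚ) ((53892790361916 : ℤ), (80940033383526 : ℤ)) ((5566684515565792 : ℤ), (5731619688139496 : ℤ)) = true := by decide +kernel

set_option maxHeartbeats 4000000 in
/-- row D of cell 140 of `L = 30` (`aD = 77/1000`). [folklore] -/
theorem xd30_140 : xdCellAnyN0 30 (49/50 : ℚ) 1837608457606559 1883548669046723 (77/1000 : ℚ) ((53892790361916 : ℤ), (80940033383526 : ℤ)) = true := by decide +kernel

set_option maxHeartbeats 4000000 in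
/-- side condition of cell 140 of `L = 30` (`c, b = 141/100, aD`). [folklore] -/
theorem sd30_140 : sdCellAnyZN 30 (49/50 : ℚ) 100 1837608457606559 1883548669046723 ((111/200 : ℚ), (141 : ℕ), (77/1000 : ℚ)) ((53892790361916 : ℤ), (80940033383526 : ℤ)) = true := by decide +kernel

set_option maxHeartbeats 4000000 in
/-- row `N₁` of cell 141 of `L = 30` (`c = 11/20`), exporting `nt`, `tb`. [folklore] -/
theorem xn30_141 : xbnCellAny2 30 (49/50 : ℚ) 1883548669046723 1930637385772892 (11/20 : ℚ) ((57483796734151 : ℤ), (86727728922220 : ℤ)) ((5708095315068124 : ℤ), (5878674375047092 : ℤ)) = true := by decide +kernel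

set_option maxHeartbeats 4000000 in
/-- row D of cell 141 of `L = 30` (`aD = 77/1000`). [folklore] -/
theorem xd30_141 : xdCellAnyN0 30 (49/50 : ℚ) 1883548669046723 1930637385772892 (77/1000 : ℚ) ((57483796734151 : ℤ), (86727728922220 : ℤ)) = true := by decide +kernel

set_option maxHeartbeats 4000000 in
/-- side condition of cell 141 of `L = 30` (`c, b = 144/100, aD`). [folklore] -/
theorem sd30_141 : sdCellAnyZN 30 (49/50 : ℚ) 100 1883548669046723 1930637385772892 ((11/20 : ℚ), (144 : ℕ), (77/1000 : ℚ)) ((57483796734151 : ℤ), (86727728922220 : ℤ)) = true := by decide +kernel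

end FinXD

end Summit.HubbardSuperconductivity.HubbardSuperconductivity.Theorems.AnisotropyChord.Transfer.Fibre3
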